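import Literature.NumberTheory.EllipticCurves.MatsunoCurves
import Literature.NumberTheory.EllipticCurves.ShaRestrictionIndex
import HarnessLib

/-!
# Matsuno 2009, Proposition 5.7: reduction to the statement over `ℚ`

`Literature/NumberTheory/EllipticCurves/MatsunoCurves.lean` vendors Proposition 5.7 of K. Matsuno,
Math. Res. Lett. 16 (2009) — "`dim_{𝔽₂} Ш(B/K)[2] ≥ 2k − 17`" for Kramer's curve `B` (6) with
Matsuno's parameters, `K/ℚ` cyclic of odd degree `n` — as the named fact
`Literature.NumberTheory.EllipticCurves.Matsuno2009_prop57`. Its printed proof (p. 458) begins: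
"Since `n = [K : ℚ]` is odd, the kernel of the restriction map `Ш(B/ℚ) → Ш(B/K)` has no element
of order `2`. Hence we have only to show `dim_{𝔽₂} Ш(B/ℚ)[2] ≥ 2k − 17`", and the rest is an
argument over `ℚ` (Cassels' formula for the Selmer groups of the `2`-isogenies `f : A → B`,
`g : B → A` [16, Theorem 1], the sequence `B(ℚ)[2] → A(ℚ)[f] → Sel^g(B/ℚ) → Sel²(B/ℚ)`,
`rank B(ℚ) = rank A(ℚ) ≤ 14` and `B(ℚ)[2] ≅ ℤ/2`).

The first step IS proved in the tree (`Literature.NumberTheory.EllipticCurves.injOn_shaRestriction_torsionBy`,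
file `ShaRestrictionIndex`: for `L/K` Galois, restriction `Ш(E/K) → Ш(E_L/L)` is injective on
`Ш(E/K)[m]` for `m` prime to `[L : K]`). This file therefore vendors the remaining printed
statement over `ℚ` as the named fact `Matsuno2009_prop57_rat` ("`dim_{𝔽₂} Ш(B/ℚ)[2] ≥ 2k − 17`",
same context) and PROVES `Matsuno2009_prop57` from it (`Matsuno2009_prop57_of_rat`): an embedded
`(ℤ/2)^{⊕c}` in `Ш(B/ℚ)[2]` is carried injectively into `Ш(B_K/K)[2]` by the restriction
`Literature.NumberTheory.EllipticCurves.shaRestriction B K`, `2` being prime to the odd degree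
`[K : ℚ]`. So `Matsuno2009_prop57` now rests on `Matsuno2009_prop57_rat` alone.

## References

* K. Matsuno, Math. Res. Lett. 16 (2009), no. 3, 449–461: Proposition 5.7 and its proof
  (p. 458). [Matsuno2009]
* R. Kloosterman, E. F. Schaefer, J. Number Theory 99 (2003) 148–163, Theorem 1 (Cassels'
  formula, Matsuno's [16]; the input of the `ℚ`-part, not read).
-/

noncomputable section

open scoped Classical NumberField

open WeierstrassCurve

namespace Literature.NumberTheory.EllipticCurves

/-- **Matsuno 2009, Proposition 5.7, the statement over `ℚ` (named fact).** In the setting of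
§5 (`K/ℚ` cyclic Galois of odd degree `n`, a positive integer `k`, primes (A1)–(A4), `s, t` from
Lemma 5.2, `B` the curve (6) `= kramerCurveB m`, `m = t m₁ⁿ⋯m_kⁿ`): "we have only to show
`dim_{𝔽₂} Ш(B/ℚ)[2] ≥ 2k − 17`" (proof of Prop. 5.7, p. 458) — established in print from Cassels'
formula for the `2`-isogenies `f : A → B`, `g : B → A` [16, Theorem 1]
(`dim Sel^g(B/ℚ) ≥ dim Sel^f(A/ℚ) + Σ_q (u_{A,q} − u_{B,q}) − 1 ≥ 2k − 1`, every `ℓ_i, m_j`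
being split multiplicative for `A` and `B` with `u_{A,q} − u_{B,q} = 1`), the exact sequence
`B(ℚ)[2] → A(ℚ)[f] → Sel^g(B/ℚ) → Sel²(B/ℚ)` (`dim Sel²(B/ℚ) ≥ 2k − 2`),
`rank B(ℚ) = rank A(ℚ) ≤ 14` ("by the same argument as in the proof of Proposition 5.4 and
Corollary 5.5") and `B(ℚ)[2] ≅ ℤ/2`, by (1): `2k − 2 − 14 − 1 = 2k − 17`. Formal statement: for
every `c` with `c + 17 ≤ 2k`, an injective homomorphism `(Fin c → ZMod 2) →+ B.sha ⊓ B.galH1[2]`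
(`B = P.curveB` over `ℚ`). The context (in particular `n`, through the exponent in `m`) is that of
`Matsuno2009_prop57`. [cite: Matsuno2009, Proposition 5.7 (proof, p. 458: the statement over ℚ)] -/
def Matsuno2009_prop57_rat : Prop :=
  ∀ (n : ℕ), Odd n → ∀ (K : Type) [Field K] [NumberField K] [IsGalois ℚ K]
    [IsCyclic (K ≃ₐ[ℚ] K)], Module.finrank ℚ K = n → ∀ (k : ℕ) (P : MatsunoParams K n k),
      ∀ c : ℕ, c + 17 ≤ 2 * k →
        ∃ f : (Fin c → ZMod 2) →+ ↥(P.curveB.sha ⊓ AddSubgroup.torsionBy P.curveB.galH1 2),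
          Function.Injective f

/-- **Restriction carries `Ш(E/ℚ)[m]` injectively into `Ш(E_K/K)[m]` for `m` prime to `[K : ℚ]`**
(`K/ℚ` Galois): an embedded copy of `(ℤ/m)^{⊕c}` in `E.sha ⊓ E.galH1[m]` yields one in
`(E_K).sha ⊓ (E_K).galH1[m]`, through `shaRestriction E K`, injective on `Ш(E/ℚ)[m]` by
`injOn_shaRestriction_torsionBy` (the kernel of restriction is killed by `[K : ℚ]`). Matsuno,
proof of Prop. 5.7: "Since `n = [K : ℚ]` is odd, the kernel of the restriction map
`Ш(B/ℚ) → Ш(B/K)` has no element of order `2`." [cite: Matsuno2009, proof of Prop. 5.7 (p. 458)] -/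
theorem exists_shaTorsion_baseChange_of_coprime (E : WeierstrassCurve ℚ) (K : Type) [Field K]
    [NumberField K] [IsGalois ℚ K] {m : ℕ} (hm : m.Coprime (Module.finrank ℚ K)) {c : ℕ}
    (h : ∃ f : (Fin c → ZMod m) →+ ↥(E.sha ⊓ AddSubgroup.torsionBy E.galH1 m),
      Function.Injective f) :
    ∃ f : (Fin c → ZMod m) →+
        ↥((E.baseChange K).sha ⊓ AddSubgroup.torsionBy (E.baseChange K).galH1 m),
      Function.Injective f := by
  obtain ⟨f, hf⟩ := h
  let ι : ↥(E.sha ⊓ AddSubgroup.torsionBy E.galH1 m) →+ E.sha :=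
    AddSubgroup.inclusion inf_le_left
  let R : E.sha →+ (E.baseChange K).sha := shaRestriction E K
  -- the composite `(Fin c → ZMod m) → Ш(E/ℚ)[m] → Ш(E/ℚ) → Ш(E_K/K) → H¹(K, E_K)`
  let F : (Fin c → ZMod m) →+ (E.baseChange K).galH1 :=
    (E.baseChange K).sha.subtype.comp (R.comp (ι.comp f))
  have hmem : ∀ v, F v ∈ (E.baseChange K).sha ⊓
      AddSubgroup.torsionBy (E.baseChange K).galH1 m := by
    intro v
    refine ⟨(R (ι (f v))).2, AddSubgroup.torsionBy.nsmul_iff.mpr ?_⟩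
    have hv : m • v = 0 := by
      funext i
      simp [Pi.smul_apply, nsmul_eq_mul]
    rw [← map_nsmul, hv, map_zero]
  refine ⟨F.codRestrict _ hmem, ?_⟩
  -- injectivity: `ι ∘ f` is injective with `m`-torsion values, and `R` is injective there
  have hιf : Function.Injective (ι.comp f) :=
    (AddSubgroup.inclusion_injective inf_le_left).comp hf
  have htors : ∀ v, ι (f v) ∈ AddSubgroup.torsionBy E.sha m := fun v =>
    AddSubgroup.torsionBy.nsmul_iff.mpr (Subtype.ext (AddSubgroup.torsionBy.nsmul_iff.mp (f v).2.2))
  have hinj : Function.Injective F := by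
    intro v w hvw
    have h1 : R (ι (f v)) = R (ι (f w)) := (E.baseChange K).sha.subtype_injective hvw
    have h2 : ι (f v) = ι (f w) := injOn_shaRestriction_torsionBy E K hm (htors v) (htors w) h1
    exact hιf h2
  intro v w hvw
  have hvw' := congrArg Subtype.val hvw
  exact hinj hvw'

/-- **Proposition 5.7 from its statement over `ℚ`**: `[K : ℚ] = n` is odd, so `2` is prime to
`[K : ℚ]` and restriction `Ш(B/ℚ)[2] → Ш(B_K/K)[2]` is injective
(`exists_shaTorsion_baseChange_of_coprime`); "Hence we have only to show
`dim_{𝔽₂} Ш(B/ℚ)[2] ≥ 2k − 17`" (`Matsuno2009_prop57_rat`).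
[cite: Matsuno2009, Proposition 5.7 (proof, p. 458)] -/
theorem Matsuno2009_prop57_of_rat (h : Matsuno2009_prop57_rat) : Matsuno2009_prop57 := by
  intro n hn K _ _ _ _ hK k P c hc
  have h2 : (2 : ℕ).Coprime (Module.finrank ℚ K) := by
    rw [hK]
    exact Nat.coprime_two_left.mpr hn
  exact exists_shaTorsion_baseChange_of_coprime P.curveB K h2 (h n hn K hK k P c hc)

end Literature.NumberTheory.EllipticCurves

end
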